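import Mathlib
import Summits.ResolutionOfSingularities.ResolutionOfSingularities.Theorems.WildQuotientsWildQuotientResolutionPthConeFanChartEnd

/-!
# The middle vertex charts `D₊(x_ρ^{a(a−1)} x_{ρ'}^{b(b+1)} t)` of the toric fan blow-up are affine spaces
(crux stmt-ResolutionOfSingularities-15640 `WildQuotients.WildQuotientResolution`, line `Sketch`;
chain w45c POST-V5 S2 = conductor-𝟙 core `ConductorOneCore p n`, brick F6 `…ConductorOneToricFan` =
toric brick `T(a,b)` of res-L1-w45c-lead-1's `S2-DESIGN.md` §3 / §7 (7.6). [OURS · L1 W4.5c] — NOT a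
statement of any manuscript; replaces the role of no printed item. Owner res-L1-w45c-stub-4 (gen 5).)

Instance TWO of the engine `PthCone.isRegularRing_chartRing_of_dualBasis` (…PthConeFanEngine): the
cone `⟨v_b, v_{b+1}, 𝐞_l (l ∈ S∖ρ), 𝐞_{l'} (l' ∈ T∖ρ')⟩` of the fan `Σ` at the MIDDLE VERTEX
`x_ρ^{a(a−1)} x_{ρ'}^{b(b+1)}` (`a + b = p`, `a ≥ 2`, `b ≥ 1`, i.e. `j = b ∈ [1, p−2]` in the numbering
`(p−j)(p−j−1), j(j+1)` of `PthCone.vtxExp`; `ρ ∈ S`, `ρ' ∈ T`). Dual basis and functionals: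
`ε_ρ = a𝐞_ρ − b𝐞_{ρ'}` (edge `x_ρ^{a²}x_{ρ'}^{b²}`, `Λ_ρ = (b+1)Σ_S + (a−1)Σ_T = p⟨v_{b+1},·⟩`),
`ε_{ρ'} = −(a−1)𝐞_ρ + (b+1)𝐞_{ρ'}` (edge `x_ρ^{(a−1)²}x_{ρ'}^{(b+1)²}`, `Λ_{ρ'} = bΣ_S + aΣ_T = p⟨v_b,·⟩`),
`ε_l = 𝐞_l − 𝐞_ρ` (`l ∈ S∖ρ`), `ε_{l'} = 𝐞_{l'} − 𝐞_{ρ'}` (`l' ∈ T∖ρ'`); chart ring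
`k[x_ρ^a/x_{ρ'}^b, x_{ρ'}^{b+1}/x_ρ^{a−1}, x_l/x_ρ, x_{l'}/x_{ρ'}]`. Generic in the monomial family `c`. No notation.
-/

set_option linter.dupNamespace false

noncomputable section

open MvPolynomial
open Literature.AlgebraicGeometry.Resolution

namespace Summit.ResolutionOfSingularities.ResolutionOfSingularities.Theorems.WildQuotientResolution.PthCone

universe u

variable (k : Type) [Field k] (n p : ℕ) (w : Fin n → ZMod p)

/-- Splitting a sum over all variables but `ρ ∈ S`, `ρ' ∈ T` along a partition `S ⊔ T`. [folklore] -/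
theorem sum_erase_erase_eq_of_partition (S T : Finset (Fin n)) (hST : ∀ l, l ∈ S ∨ l ∈ T)
    (hdisj : ∀ l, ¬(l ∈ S ∧ l ∈ T)) (ρ : Fin n) (hρ : ρ ∈ S) (ρ' : Fin n) (hρ' : ρ' ∈ T)
    (f : Fin n → ℤ) :
    ∑ l ∈ (Finset.univ.erase ρ).erase ρ', f l = ∑ l ∈ S.erase ρ, f l + ∑ l ∈ T.erase ρ', f l := by
  classical
  have hne : ρ' ≠ ρ := fun h => hdisj ρ ⟨hρ, h ▸ hρ'⟩
  have h1 := Finset.add_sum_erase (Finset.univ.erase ρ) f (Finset.mem_erase.mpr ⟨hne, Finset.mem_univ ρ'⟩)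
  have h2 := sum_erase_eq_of_partition n S T hST hdisj ρ hρ f
  have h3 := Finset.add_sum_erase T f hρ'
  linarith

-- the proof instantiates the symbolic engine; many case distinctions on the variables
set_option maxHeartbeats 1600000 in
/-- **The middle vertex chart is an affine space.** Let `𝔞 = (c_0,…,c_{N−1})` be a monomial ideal of
the cone `(1/p)(w)`, `S ⊔ T` a partition of the variables with `p ∣ Σ_S d − Σ_T d` for every weight-`0`
exponent `d`, `a + b = p`, `a ≥ 2`, `b ≥ 1`, `ρ ∈ S`, `ρ' ∈ T`, `c_j = x_ρ^{a(a−1)} x_{ρ'}^{b(b+1)}`, and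
suppose `x_ρ^{a²}x_{ρ'}^{b²}`, `x_ρ^{(a−1)²}x_{ρ'}^{(b+1)²}`, `x_ρ^{a(a−1)−1}x_{ρ'}^{b(b+1)}x_l`
(`l ∈ S∖ρ`), `x_ρ^{a(a−1)}x_{ρ'}^{b(b+1)−1}x_{l'}` (`l' ∈ T∖ρ'`) occur among the `c_i`, all of which are
monomials `x^d` with `bΣ_S d + aΣ_T d ≥ pab` and `(b+1)Σ_S d + (a−1)Σ_T d ≥ p(b+1)(a−1)`. Then the chart
ring `(cone[𝔞t])_{(c_j t)}` is regular (a polynomial ring). [OURS · L1 W4.5c] -/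
theorem isRegularRing_chartRing_midVertex {N : ℕ} (c : Fin N → cone k n p w) (j : Fin N)
    (S T : Finset (Fin n)) (hST : ∀ l, l ∈ S ∨ l ∈ T) (hdisj : ∀ l, ¬(l ∈ S ∧ l ∈ T))
    (hdivw : ∀ d : Fin n →₀ ℕ, Finsupp.weight w d = 0 →
      (p : ℤ) ∣ (∑ l ∈ S, (d l : ℤ)) - ∑ l ∈ T, (d l : ℤ))
    (a b : ℕ) (ha : 2 ≤ a) (hb : 1 ≤ b) (hab : a + b = p)
    (ρ : Fin n) (hρ : ρ ∈ S) (ρ' : Fin n) (hρ' : ρ' ∈ T)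
    (hcj : ((c j : cone k n p w) : MvPolynomial (Fin n) k) =
      monomial (Finsupp.single ρ (a * (a - 1)) + Finsupp.single ρ' (b * (b + 1))) 1)
    (iq : Fin N) (hiq : ((c iq : cone k n p w) : MvPolynomial (Fin n) k) =
      monomial (Finsupp.single ρ (a ^ 2) + Finsupp.single ρ' (b ^ 2)) 1)
    (iq' : Fin N) (hiq' : ((c iq' : cone k n p w) : MvPolynomial (Fin n) k) =
      monomial (Finsupp.single ρ ((a - 1) ^ 2) + Finsupp.single ρ' ((b + 1) ^ 2)) 1)
    (ie : Fin n → Fin N) (hie : ∀ l ∈ S, l ≠ ρ → ((c (ie l) : cone k n p w) : MvPolynomial (Fin n) k) =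
      monomial (Finsupp.single ρ (a * (a - 1) - 1) + Finsupp.single ρ' (b * (b + 1)) +
        Finsupp.single l 1) 1)
    (ix : Fin n → Fin N) (hix : ∀ l ∈ T, l ≠ ρ' → ((c (ix l) : cone k n p w) : MvPolynomial (Fin n) k) =
      monomial (Finsupp.single ρ (a * (a - 1)) + Finsupp.single ρ' (b * (b + 1) - 1) +
        Finsupp.single l 1) 1)
    (hgen : ∀ i : Fin N, ∃ d : Fin n →₀ ℕ, ((c i : cone k n p w) : MvPolynomial (Fin n) k) = monomial d 1 ∧
      (p : ℤ) * b * a ≤ (b : ℤ) * (∑ l ∈ S, (d l : ℤ)) + a * ∑ l ∈ T, (d l : ℤ) ∧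
      (p : ℤ) * (b + 1) * (a - 1) ≤ ((b : ℤ) + 1) * (∑ l ∈ S, (d l : ℤ)) + ((a : ℤ) - 1) * ∑ l ∈ T, (d l : ℤ)) :
    IsRegularRing (chartRing c j) := by
  classical
  -- basic facts about the partition
  have hρT : ρ ∉ T := fun h => hdisj ρ ⟨hρ, h⟩
  have hρ'S : ρ' ∉ S := fun h => hdisj ρ' ⟨h, hρ'⟩
  have hne : ρ' ≠ ρ := fun h => hρ'S (h ▸ hρ)
  have hne' : ρ ≠ ρ' := fun h => hne h.symm
  have hSn : ∀ l ∈ S, l ∉ T := fun l hl h => hdisj l ⟨hl, h⟩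
  have hTn : ∀ l ∈ T, l ∉ S := fun l hl h => hdisj l ⟨h, hl⟩
  have hp : 0 < p := by omega
  have hpab : (p : ℤ) = a + b := by rw [← hab]; push_cast; ring
  have ha1 : 1 ≤ a := by omega
  have haa : 1 ≤ a * (a - 1) := Nat.one_le_iff_ne_zero.mpr (Nat.mul_ne_zero (by omega) (by omega))
  have hbb : 1 ≤ b * (b + 1) := Nat.one_le_iff_ne_zero.mpr (Nat.mul_ne_zero (by omega) (by omega))
  have casta1 : ((a - 1 : ℕ) : ℤ) = (a : ℤ) - 1 := by rw [Nat.cast_sub ha1, Nat.cast_one]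
  have castaa : ((a * (a - 1) : ℕ) : ℤ) = (a : ℤ) * (a - 1) := by rw [Nat.cast_mul, casta1]
  have castaa1 : ((a * (a - 1) - 1 : ℕ) : ℤ) = (a : ℤ) * (a - 1) - 1 := by
    rw [Nat.cast_sub haa, castaa, Nat.cast_one]
  have castbb : ((b * (b + 1) : ℕ) : ℤ) = (b : ℤ) * (b + 1) := by push_cast; ring
  have castbb1 : ((b * (b + 1) - 1 : ℕ) : ℤ) = (b : ℤ) * (b + 1) - 1 := by
    rw [Nat.cast_sub hbb, castbb, Nat.cast_one]
  have castasq : (((a - 1) ^ 2 : ℕ) : ℤ) = ((a : ℤ) - 1) ^ 2 := by rw [Nat.cast_pow, casta1]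
  -- the scaled ray functionals
  let Λ : Fin n → ((Fin n → ℤ) →+ ℤ) := fun l =>
    AddMonoidHom.mk' (fun m =>
      if l = ρ then ((b : ℤ) + 1) * (∑ i ∈ S, m i) + ((a : ℤ) - 1) * ∑ i ∈ T, m i
      else if l = ρ' then (b : ℤ) * (∑ i ∈ S, m i) + (a : ℤ) * ∑ i ∈ T, m i
      else (p : ℤ) * m l) (by
        intro m m'
        by_cases h : l = ρ
        · simp only [if_pos h, Pi.add_apply, Finset.sum_add_distrib]; ring
        · by_cases h' : l = ρ'
          · simp only [if_neg h, if_pos h', Pi.add_apply, Finset.sum_add_distrib]; ring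
          · simp only [if_neg h, if_neg h', Pi.add_apply]; ring)
  have hΛρ : ∀ m : Fin n → ℤ, Λ ρ m = ((b : ℤ) + 1) * (∑ i ∈ S, m i) + ((a : ℤ) - 1) * ∑ i ∈ T, m i :=
    fun m => by simp [Λ]
  have hΛρ' : ∀ m : Fin n → ℤ, Λ ρ' m = (b : ℤ) * (∑ i ∈ S, m i) + (a : ℤ) * ∑ i ∈ T, m i :=
    fun m => by simp [Λ, hne]
  have hΛl : ∀ l, l ≠ ρ → l ≠ ρ' → ∀ m : Fin n → ℤ, Λ l m = (p : ℤ) * m l := fun l hl hl' m => by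
    simp [Λ, hl, hl']
  -- the dual vectors
  let ε : Fin n → Fin n → ℤ := fun l i =>
    if l = ρ then (a : ℤ) * (if i = ρ then 1 else 0) - (b : ℤ) * (if i = ρ' then 1 else 0)
    else if l = ρ' then -(((a : ℤ) - 1) * (if i = ρ then 1 else 0)) + ((b : ℤ) + 1) * (if i = ρ' then 1 else 0)
    else (if i = l then 1 else 0) -
      (if l ∈ S then (if i = ρ then 1 else 0) else (if i = ρ' then 1 else 0))
  have hερ : ∀ i, ε ρ i = (a : ℤ) * (if i = ρ then 1 else 0) - (b : ℤ) * (if i = ρ' then 1 else 0) :=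
    fun i => by simp [ε]
  have hερ' : ∀ i, ε ρ' i =
      -(((a : ℤ) - 1) * (if i = ρ then 1 else 0)) + ((b : ℤ) + 1) * (if i = ρ' then 1 else 0) :=
    fun i => by simp [ε, hne]
  have hεS : ∀ l ∈ S, l ≠ ρ → ∀ i, ε l i = (if i = l then 1 else 0) - (if i = ρ then 1 else 0) :=
    fun l hl hlρ i => by simp [ε, hlρ, show l ≠ ρ' from fun h => hρ'S (h ▸ hl), hl]
  have hεT : ∀ l ∈ T, l ≠ ρ' → ∀ i, ε l i = (if i = l then 1 else 0) - (if i = ρ' then 1 else 0) :=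
    fun l hl hlρ' i => by simp [ε, hlρ', show l ≠ ρ from fun h => hρT (h ▸ hl), hTn l hl]
  -- splitting sums over all variables: `ρ`, `ρ'`, the rest
  have hsplit : ∀ f : Fin n → ℤ, ∑ l, f l = f ρ + f ρ' +
      (∑ l ∈ S.erase ρ, f l + ∑ l ∈ T.erase ρ', f l) := by
    intro f
    rw [← sum_erase_erase_eq_of_partition n S T hST hdisj ρ hρ ρ' hρ',
      ← Finset.add_sum_erase Finset.univ f (Finset.mem_univ ρ),
      ← Finset.add_sum_erase (Finset.univ.erase ρ) f (Finset.mem_erase.mpr ⟨hne, Finset.mem_univ ρ'⟩)]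
    ring
  have hSsum : ∀ f : Fin n → ℤ, ∑ l ∈ S, f l = f ρ + ∑ l ∈ S.erase ρ, f l := fun f =>
    (Finset.add_sum_erase S f hρ).symm
  have hTsum : ∀ f : Fin n → ℤ, ∑ l ∈ T, f l = f ρ' + ∑ l ∈ T.erase ρ', f l := fun f =>
    (Finset.add_sum_erase T f hρ').symm
  have hsingle : ∀ (a' : Fin n) (b' : ℕ) (i : Fin n),
      ((Finsupp.single a' b' i : ℕ) : ℤ) = if i = a' then (b' : ℤ) else 0 := by
    intro a' b' i
    rw [Finsupp.single_apply]
    by_cases h : i = a'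
    · rw [if_pos h.symm, if_pos h]
    · rw [if_neg (Ne.symm h), if_neg h, Nat.cast_zero]
  refine isRegularRing_chartRing_of_dualBasis k n p w c j hp
    (Finsupp.single ρ (a * (a - 1)) + Finsupp.single ρ' (b * (b + 1))) hcj Λ ε ?_ ?_ ?_ ?_
    (fun l => if l = ρ then iq else if l = ρ' then iq' else if l ∈ S then ie l else ix l)
    (fun l => if l = ρ then Finsupp.single ρ (a ^ 2) + Finsupp.single ρ' (b ^ 2)
      else if l = ρ' then Finsupp.single ρ ((a - 1) ^ 2) + Finsupp.single ρ' ((b + 1) ^ 2)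
      else if l ∈ S then Finsupp.single ρ (a * (a - 1) - 1) + Finsupp.single ρ' (b * (b + 1)) +
        Finsupp.single l 1
      else Finsupp.single ρ (a * (a - 1)) + Finsupp.single ρ' (b * (b + 1) - 1) + Finsupp.single l 1)
    ?_ ?_ ?_
  · -- duality `p m_i = Σ_l Λ_l(m) ε_l(i)`
    intro m i
    rw [hsplit (fun l => Λ l m * ε l i), hΛρ, hΛρ', hερ, hερ']
    have hrestS : ∀ l ∈ S.erase ρ, Λ l m * ε l i =
        (p : ℤ) * m l * ((if i = l then 1 else 0) - (if i = ρ then 1 else 0)) := by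
      intro l hl
      have hlS := Finset.mem_of_mem_erase hl
      have hlρ := Finset.ne_of_mem_erase hl
      rw [hΛl l hlρ (fun h => hρ'S (h ▸ hlS)), hεS l hlS hlρ]
    have hrestT : ∀ l ∈ T.erase ρ', Λ l m * ε l i =
        (p : ℤ) * m l * ((if i = l then 1 else 0) - (if i = ρ' then 1 else 0)) := by
      intro l hl
      have hlT := Finset.mem_of_mem_erase hl
      have hlρ' := Finset.ne_of_mem_erase hl
      rw [hΛl l (fun h => hρT (h ▸ hlT)) hlρ', hεT l hlT hlρ']
    rw [Finset.sum_congr rfl hrestS, Finset.sum_congr rfl hrestT]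
    by_cases hi : i = ρ
    · rw [hi, if_pos rfl, if_neg hne']
      have hzS : ∀ l ∈ S.erase ρ, (p : ℤ) * m l * ((if ρ = l then 1 else 0) - 1) = -((p : ℤ) * m l) := by
        intro l hl
        rw [if_neg (Finset.ne_of_mem_erase hl).symm]; ring
      have hzT : ∀ l ∈ T.erase ρ', (p : ℤ) * m l * ((if ρ = l then 1 else 0) - 0) = 0 := by
        intro l hl
        rw [if_neg (fun h : ρ = l => hρT (h ▸ Finset.mem_of_mem_erase hl))]; ring
      rw [Finset.sum_congr rfl hzS, Finset.sum_congr rfl hzT, Finset.sum_neg_distrib, ← Finset.mul_sum,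
        Finset.sum_const_zero, hSsum m, hpab]
      ring
    · by_cases hi' : i = ρ'
      · rw [hi', if_neg hne, if_pos rfl]
        have hzS : ∀ l ∈ S.erase ρ, (p : ℤ) * m l * ((if ρ' = l then 1 else 0) - 0) = 0 := by
          intro l hl
          rw [if_neg (fun h : ρ' = l => hρ'S (h ▸ Finset.mem_of_mem_erase hl))]; ring
        have hzT : ∀ l ∈ T.erase ρ', (p : ℤ) * m l * ((if ρ' = l then 1 else 0) - 1) = -((p : ℤ) * m l) := by
          intro l hl
          rw [if_neg (Finset.ne_of_mem_erase hl).symm]; ring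
        rw [Finset.sum_congr rfl hzS, Finset.sum_congr rfl hzT, Finset.sum_neg_distrib, ← Finset.mul_sum,
          Finset.sum_const_zero, hTsum m, hpab]
        ring
      · rw [if_neg hi, if_neg hi']
        have hzS : ∀ l ∈ S.erase ρ, (p : ℤ) * m l * ((if i = l then 1 else 0) - 0) =
            if i = l then (p : ℤ) * m l else 0 := by
          intro l hl; split_ifs <;> ring
        have hzT : ∀ l ∈ T.erase ρ', (p : ℤ) * m l * ((if i = l then 1 else 0) - 0) =
            if i = l then (p : ℤ) * m l else 0 := by
          intro l hl; split_ifs <;> ring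
        rw [Finset.sum_congr rfl hzS, Finset.sum_congr rfl hzT, Finset.sum_ite_eq, Finset.sum_ite_eq]
        rcases hST i with hS | hT
        · rw [if_pos (Finset.mem_erase.mpr ⟨hi, hS⟩), if_neg (fun h => hSn i hS (Finset.mem_of_mem_erase h))]
          ring
        · rw [if_neg (fun h => hTn i hT (Finset.mem_of_mem_erase h)), if_pos (Finset.mem_erase.mpr ⟨hi', hT⟩)]
          ring
  · -- biorthogonality
    -- sums of the dual vectors over `S` and `T`
    have hind : ∀ (U : Finset (Fin n)) (x : Fin n),
        (∑ i ∈ U, if i = x then (1 : ℤ) else 0) = if x ∈ U then 1 else 0 :=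
      fun U x => Finset.sum_ite_eq' U x (fun _ => 1)
    have sρS : ∑ i ∈ S, ε ρ i = a := by
      rw [Finset.sum_congr rfl (fun i _ => hερ i), Finset.sum_sub_distrib, ← Finset.mul_sum,
        ← Finset.mul_sum, hind, hind, if_pos hρ, if_neg hρ'S]; ring
    have sρT : ∑ i ∈ T, ε ρ i = -b := by
      rw [Finset.sum_congr rfl (fun i _ => hερ i), Finset.sum_sub_distrib, ← Finset.mul_sum,
        ← Finset.mul_sum, hind, hind, if_neg hρT, if_pos hρ']; ring
    have sρ'S : ∑ i ∈ S, ε ρ' i = -((a : ℤ) - 1) := by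
      rw [Finset.sum_congr rfl (fun i _ => hερ' i), Finset.sum_add_distrib, Finset.sum_neg_distrib,
        ← Finset.mul_sum, ← Finset.mul_sum, hind, hind, if_pos hρ, if_neg hρ'S]; ring
    have sρ'T : ∑ i ∈ T, ε ρ' i = (b : ℤ) + 1 := by
      rw [Finset.sum_congr rfl (fun i _ => hερ' i), Finset.sum_add_distrib, Finset.sum_neg_distrib,
        ← Finset.mul_sum, ← Finset.mul_sum, hind, hind, if_neg hρT, if_pos hρ']; ring
    have sSS : ∀ l ∈ S, l ≠ ρ → ∑ i ∈ S, ε l i = 0 := by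
      intro l hl hlρ
      rw [Finset.sum_congr rfl (fun i _ => hεS l hl hlρ i), Finset.sum_sub_distrib, hind, hind,
        if_pos hl, if_pos hρ]; ring
    have sST : ∀ l ∈ S, l ≠ ρ → ∑ i ∈ T, ε l i = 0 := by
      intro l hl hlρ
      rw [Finset.sum_congr rfl (fun i _ => hεS l hl hlρ i), Finset.sum_sub_distrib, hind, hind,
        if_neg (hSn l hl), if_neg hρT]; ring
    have sTS : ∀ l ∈ T, l ≠ ρ' → ∑ i ∈ S, ε l i = 0 := by
      intro l hl hlρ'
      rw [Finset.sum_congr rfl (fun i _ => hεT l hl hlρ' i), Finset.sum_sub_distrib, hind, hind,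
        if_neg (hTn l hl), if_neg hρ'S]; ring
    have sTT : ∀ l ∈ T, l ≠ ρ' → ∑ i ∈ T, ε l i = 0 := by
      intro l hl hlρ'
      rw [Finset.sum_congr rfl (fun i _ => hεT l hl hlρ' i), Finset.sum_sub_distrib, hind, hind,
        if_pos hl, if_pos hρ']; ring
    intro l l'
    by_cases hl'ρ : l' = ρ
    · rw [hl'ρ, hΛρ]
      by_cases hlρ : l = ρ
      · rw [hlρ, sρS, sρT, if_pos rfl, hpab]; ring
      · rw [if_neg hlρ]
        by_cases hlρ' : l = ρ'
        · rw [hlρ', sρ'S, sρ'T]; ring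
        · rcases hST l with hS | hT
          · rw [sSS l hS hlρ, sST l hS hlρ]; ring
          · rw [sTS l hT hlρ', sTT l hT hlρ']; ring
    · by_cases hl'ρ' : l' = ρ'
      · rw [hl'ρ', hΛρ']
        by_cases hlρ : l = ρ
        · rw [hlρ, sρS, sρT, if_neg hne']; ring
        · by_cases hlρ' : l = ρ'
          · rw [hlρ', sρ'S, sρ'T, if_pos rfl, hpab]; ring
          · rw [if_neg hlρ']
            rcases hST l with hS | hT
            · rw [sSS l hS hlρ, sST l hS hlρ]; ring
            · rw [sTS l hT hlρ', sTT l hT hlρ']; ring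
      · rw [hΛl l' hl'ρ hl'ρ']
        by_cases hlρ : l = ρ
        · rw [hlρ, hερ, if_neg hl'ρ, if_neg hl'ρ', if_neg (Ne.symm hl'ρ)]; ring
        · by_cases hlρ' : l = ρ'
          · rw [hlρ', hερ', if_neg hl'ρ, if_neg hl'ρ', if_neg (Ne.symm hl'ρ')]; ring
          · rcases hST l with hS | hT
            · rw [hεS l hS hlρ, if_neg hl'ρ]
              by_cases hll : l = l'
              · rw [hll, if_pos rfl, if_pos rfl]; ring
              · rw [if_neg (Ne.symm hll), if_neg hll]; ring
            · rw [hεT l hT hlρ', if_neg hl'ρ']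
              by_cases hll : l = l'
              · rw [hll, if_pos rfl, if_pos rfl]; ring
              · rw [if_neg (Ne.symm hll), if_neg hll]; ring
  · -- divisibility on weight-`0` exponents
    intro d hd l
    have h := hdivw d hd
    by_cases hl : l = ρ
    · rw [hl, hΛρ]
      have : ((b : ℤ) + 1) * (∑ i ∈ S, (d i : ℤ)) + ((a : ℤ) - 1) * ∑ i ∈ T, (d i : ℤ) =
          ((b : ℤ) + 1) * ((∑ i ∈ S, (d i : ℤ)) - ∑ i ∈ T, (d i : ℤ)) + (p : ℤ) * ∑ i ∈ T, (d i : ℤ) := by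
        rw [hpab]; ring
      rw [this]
      exact dvd_add (dvd_mul_of_dvd_right h _) (dvd_mul_right _ _)
    · by_cases hl' : l = ρ'
      · rw [hl', hΛρ']
        have : (b : ℤ) * (∑ i ∈ S, (d i : ℤ)) + (a : ℤ) * ∑ i ∈ T, (d i : ℤ) =
            (b : ℤ) * ((∑ i ∈ S, (d i : ℤ)) - ∑ i ∈ T, (d i : ℤ)) + (p : ℤ) * ∑ i ∈ T, (d i : ℤ) := by
          rw [hpab]; ring
        rw [this]
        exact dvd_add (dvd_mul_of_dvd_right h _) (dvd_mul_right _ _)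
      · rw [hΛl l hl hl']
        exact dvd_mul_right _ _
  · -- non-negativity
    intro d l
    have h1 : 0 ≤ ∑ i ∈ S, ((d i : ℕ) : ℤ) := Finset.sum_nonneg fun i _ => by positivity
    have h2 : 0 ≤ ∑ i ∈ T, ((d i : ℕ) : ℤ) := Finset.sum_nonneg fun i _ => by positivity
    have h3 : (0 : ℤ) ≤ (a : ℤ) - 1 := by linarith [show (2 : ℤ) ≤ a by exact_mod_cast ha]
    by_cases hl : l = ρ
    · rw [hl, hΛρ]; positivity
    · by_cases hl' : l = ρ'
      · rw [hl', hΛρ']; positivity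
      · rw [hΛl l hl hl']; positivity
  · -- the edge generators occur in the family
    intro l
    by_cases hl : l = ρ
    · rw [hl, if_pos rfl, if_pos rfl]; exact hiq
    · by_cases hl' : l = ρ'
      · rw [hl', if_neg hne, if_neg hne, if_pos rfl, if_pos rfl]; exact hiq'
      · rcases hST l with hS | hT
        · simp only [if_neg hl, if_neg hl', if_pos hS]; exact hie l hS hl
        · simp only [if_neg hl, if_neg hl', if_neg (hTn l hT)]; exact hix l hT hl'
  · -- edge exponents `= m_τ + ε_l`
    intro l i
    rw [Finsupp.coe_add, Pi.add_apply, Nat.cast_add, hsingle, hsingle]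
    by_cases hl : l = ρ
    · rw [hl, if_pos rfl, hερ, Finsupp.coe_add, Pi.add_apply, Nat.cast_add, hsingle, hsingle]
      by_cases hi : i = ρ
      · have hi' : ¬i = ρ' := fun h => hne' (hi.symm.trans h)
        simp only [if_pos hi, if_neg hi', castaa]; push_cast; ring
      · by_cases hi' : i = ρ'
        · simp only [if_neg hi, if_pos hi', castbb]; push_cast; ring
        · simp only [if_neg hi, if_neg hi']; ring
    · by_cases hl' : l = ρ'
      · rw [hl', if_neg hne, if_pos rfl, hερ', Finsupp.coe_add, Pi.add_apply, Nat.cast_add, hsingle, hsingle]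
        by_cases hi : i = ρ
        · have hi' : ¬i = ρ' := fun h => hne' (hi.symm.trans h)
          simp only [if_pos hi, if_neg hi', castaa, castasq]; ring
        · by_cases hi' : i = ρ'
          · simp only [if_neg hi, if_pos hi', castbb]; push_cast; ring
          · simp only [if_neg hi, if_neg hi']; ring
      · rcases hST l with hS | hT
        · rw [if_neg hl, if_neg hl', if_pos hS, hεS l hS hl, Finsupp.coe_add, Finsupp.coe_add, Pi.add_apply,
            Pi.add_apply, Nat.cast_add, Nat.cast_add, hsingle, hsingle, hsingle]
          by_cases hi : i = ρ
          · have hi' : ¬i = ρ' := fun h => hne' (hi.symm.trans h)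
            have hil : ¬i = l := fun h => hl (h.symm.trans hi)
            simp only [if_pos hi, if_neg hi', if_neg hil, castaa, castaa1]; ring
          · by_cases hi' : i = ρ'
            · have hil : ¬i = l := fun h => hρ'S ((h.symm.trans hi') ▸ hS)
              simp only [if_neg hi, if_pos hi', if_neg hil]; ring
            · by_cases hil : i = l
              · simp only [if_neg hi, if_neg hi', if_pos hil]; push_cast
              · simp only [if_neg hi, if_neg hi', if_neg hil]; ring
        · rw [if_neg hl, if_neg hl', if_neg (hTn l hT), hεT l hT hl', Finsupp.coe_add, Finsupp.coe_add,
            Pi.add_apply, Pi.add_apply, Nat.cast_add, Nat.cast_add, hsingle, hsingle, hsingle]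
          by_cases hi : i = ρ
          · have hi' : ¬i = ρ' := fun h => hne' (hi.symm.trans h)
            have hil : ¬i = l := fun h => hρT ((h.symm.trans hi) ▸ hT)
            simp only [if_pos hi, if_neg hi', if_neg hil]; ring
          · by_cases hi' : i = ρ'
            · have hil : ¬i = l := fun h => hl' (h.symm.trans hi')
              simp only [if_neg hi, if_pos hi', if_neg hil, castbb, castbb1]; ring
            · by_cases hil : i = l
              · simp only [if_neg hi, if_neg hi', if_pos hil]; push_cast
              · simp only [if_neg hi, if_neg hi', if_neg hil]; ring
  · -- every generator lies on the right side of the two facets through the vertex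
    intro i
    obtain ⟨d, hd, hle, hle'⟩ := hgen i
    refine ⟨d, hd, fun l => ?_⟩
    have evS : (∑ i ∈ S, (((Finsupp.single ρ (a * (a - 1)) + Finsupp.single ρ' (b * (b + 1)) :
        Fin n →₀ ℕ) i : ℕ) : ℤ)) = (a : ℤ) * (a - 1) := by
      simp only [Finsupp.coe_add, Pi.add_apply, Nat.cast_add, hsingle, Finset.sum_add_distrib]
      rw [Finset.sum_ite_eq' S ρ, if_pos hρ, Finset.sum_ite_eq' S ρ', if_neg hρ'S, castaa, add_zero]
    have evT : (∑ i ∈ T, (((Finsupp.single ρ (a * (a - 1)) + Finsupp.single ρ' (b * (b + 1)) :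
        Fin n →₀ ℕ) i : ℕ) : ℤ)) = (b : ℤ) * (b + 1) := by
      simp only [Finsupp.coe_add, Pi.add_apply, Nat.cast_add, hsingle, Finset.sum_add_distrib]
      rw [Finset.sum_ite_eq' T ρ, if_neg hρT, Finset.sum_ite_eq' T ρ', if_pos hρ', castbb, zero_add]
    by_cases hl : l = ρ
    · rw [hl, hΛρ, hΛρ, evS, evT]
      calc ((b : ℤ) + 1) * ((a : ℤ) * (a - 1)) + ((a : ℤ) - 1) * ((b : ℤ) * (b + 1))
          = (p : ℤ) * (b + 1) * (a - 1) := by rw [hpab]; ring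
        _ ≤ _ := hle'
    · by_cases hl' : l = ρ'
      · rw [hl', hΛρ', hΛρ', evS, evT]
        calc (b : ℤ) * ((a : ℤ) * (a - 1)) + (a : ℤ) * ((b : ℤ) * (b + 1)) = (p : ℤ) * b * a := by
              rw [hpab]; ring
          _ ≤ _ := hle
      · rw [hΛl l hl hl', hΛl l hl hl', Finsupp.coe_add, Pi.add_apply, Nat.cast_add, hsingle, hsingle,
          if_neg hl, if_neg hl']
        positivity

end Summit.ResolutionOfSingularities.ResolutionOfSingularities.Theorems.WildQuotientResolution.PthCone

end
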